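import Mathlib
import Summits.NavierStokesRegularity.NavierStokesRegularity.Theorems.HeteroclinicTriggerChainTriggerChainFrontStepTruncPassage
import HarnessLib

/-!
# `HeteroclinicTriggerChain` — crux `TriggerChainFrontStep` (item stmt-NavierStokesRegularity-22785):
  IGNITION in the seeded two-shell truncation — existence of the ignition time, the state at ignition,
  and the transfer-window bound on the upper trigger

Continuation of `…TriggerChainFrontStepTruncPassage` (delay phase of the hop of the trigger chain on the
seeded two-shell truncation `x′ = −eu² − βuv`, `u′ = exu − guy`, `y′ = gu² − e′v²`, `v′ = βxu + e′yv`).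

* `htcTP_upper_transfer_bound` — Grönwall bound for the upper trigger on ANY window (in particular the
  transfer phase after ignition, where the receiver `y` is no longer small): if `βxu ≤ K`, `y ≤ Y` and
  `v ≥ 0` on `[0, t]` then `v(s) ≤ (v(0) + Ks)·e^{e′Ys}`. This is the `|v| ≤ V` input of the forced
  transfer–capture lemma `heteroclinicTriggerChain_trunc_capture` (tree file `…ForcedArc`), and the
  quantitative form of the premature-ignition factor `e^{e′∫y}`.
* `heteroclinicTriggerChain_trunc_ignition_exists` — IGNITION HAPPENS, ON TIME: under the hypotheses of
  the delay-phase theorem with an amplification budget `Λ ≥ e′δ₂T_max` for a horizon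
  `T_max > log(h/u(0))/(e(1−ε))`, the trigger reaches the level `h > u(0)` at a first time
  `T_h ∈ [log(h/u(0))/e, log(h/u(0))/(e(1−ε))]`, `u < h` before `T_h`, and the state at ignition satisfies
  `1 − δ₁ ≤ x ≤ 1`, `y(0) ≤ y ≤ δ₂`, `v(0) + β(1−δ₁)(h − u(0))/e ≤ v ≤ e^{2Λ}(v(0) + 2βh/e)` — the seed
  handed to the next shell at ignition is `≍ βh/e`, INDEPENDENT of the incoming seed `u(0)` (the
  self-similarity mechanism of the chain: the seed is regenerated by the table constant `β` at every hop,
  not inherited). First-hit time by `sInf` over the closed set `{s ∈ [0,T_max] : u(s) ≥ h}`.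

HONEST FRAMING: elementary facts about a four-dimensional quadratic ODE (a MODEL truncation of Tao's
lattice, Tao 2016 §4); helper lemmas for the crux, no stub credit; nothing here is a statement about the
Navier–Stokes equations; no summit, rung or crux is proved. NS regularity is not proved by this line.
-/

noncomputable section

-- the sub-problem namespace `Summit.NavierStokesRegularity.NavierStokesRegularity` repeats the summit name by design (D-0017)
set_option linter.dupNamespace false

open Real Set

namespace Summit.NavierStokesRegularity.NavierStokesRegularity.Theorems

/-- **Upper trigger on a transfer window (Grönwall form).** If `v′ = βxu + e′yv` with `βxu ≤ K`
(`K ≥ 0`), `y ≤ Y` (`Y ≥ 0`, `e′ ≥ 0`) and `v ≥ 0` on `[0, t]`, then `v(s) ≤ (v(0) + K s) e^{e′Y s}` on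
`[0, t]` (`W = v·e^{−e′Ys} − Ks` is non-increasing). [folklore] -/
theorem htcTP_upper_transfer_bound {x u y v : ℝ → ℝ} {β e' K Y : ℝ} (he' : 0 ≤ e') (hK : 0 ≤ K)
    (hY : 0 ≤ Y) (hv : ∀ s, HasDerivAt v (β * x s * u s + e' * y s * v s) s)
    {t : ℝ} (hxu : ∀ s ∈ Icc 0 t, β * x s * u s ≤ K) (hyY : ∀ s ∈ Icc 0 t, y s ≤ Y)
    (hvnn : ∀ s ∈ Icc 0 t, 0 ≤ v s) :
    ∀ s ∈ Icc 0 t, v s ≤ (v 0 + K * s) * Real.exp (e' * Y * s) := by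
  have hW : ∀ s, HasDerivAt (fun q => v q * Real.exp (-(e' * Y * q)) - K * q)
      ((β * x s * u s + e' * y s * v s) * Real.exp (-(e' * Y * s)) +
        v s * (Real.exp (-(e' * Y * s)) * (-(e' * Y))) - K * 1) s :=
    fun s => ((hv s).mul (htcTP_hasDerivAt_exp_neg_mul _ s)).sub ((hasDerivAt_id s).const_mul K)
  have hW' : ∀ s ∈ Icc 0 t, (β * x s * u s + e' * y s * v s) * Real.exp (-(e' * Y * s)) +
        v s * (Real.exp (-(e' * Y * s)) * (-(e' * Y))) - K * 1 ≤ 0 := by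
    intro s hs
    set E : ℝ := Real.exp (-(e' * Y * s)) with hE
    have hE0 : 0 ≤ E := (Real.exp_pos _).le
    have hE1 : E ≤ 1 := by
      rw [hE, Real.exp_le_one_iff, neg_nonpos]
      have := hs.1
      positivity
    have h1 : β * x s * u s * E ≤ K := by
      calc β * x s * u s * E ≤ K * E := mul_le_mul_of_nonneg_right (hxu s hs) hE0
        _ ≤ K * 1 := mul_le_mul_of_nonneg_left hE1 hK
        _ = K := mul_one K
    have h2 : e' * y s * v s * E + v s * (E * (-(e' * Y))) ≤ 0 := by
      have h3 : e' * y s * v s * E + v s * (E * (-(e' * Y))) = -(e' * v s * (Y - y s) * E) := by ring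
      rw [h3, neg_nonpos]
      have h4 : 0 ≤ Y - y s := by linarith [hyY s hs]
      have h5 := hvnn s hs
      positivity
    have h3 : (β * x s * u s + e' * y s * v s) * E + v s * (E * (-(e' * Y))) - K * 1 =
        β * x s * u s * E + (e' * y s * v s * E + v s * (E * (-(e' * Y)))) - K := by ring
    rw [h3]
    linarith
  have hWle := htcTP_le_of_deriv_nonpos hW hW'
  intro s hs
  have h1 := hWle s hs
  simp only [mul_zero, neg_zero, Real.exp_zero, mul_one, sub_zero] at h1
  have h2 : v s * Real.exp (-(e' * Y * s)) ≤ v 0 + K * s := by linarith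
  have h3 : v s = v s * Real.exp (-(e' * Y * s)) * Real.exp (e' * Y * s) := by
    rw [mul_assoc, ← Real.exp_add, neg_add_cancel, Real.exp_zero, mul_one]
  rw [h3]
  exact mul_le_mul_of_nonneg_right h2 (Real.exp_pos _).le

/-- **IGNITION HAPPENS, ON TIME, WITH A REGENERATED SEED** (helper for item
stmt-NavierStokesRegularity-22785). In the seeded two-shell truncation (`e, g > 0`, `e′, β ≥ 0`, energy
`≤ 1`, `0 < u(0) < h`, `y(0), v(0) ≥ 0`) with the constants of `heteroclinicTriggerChain_trunc_delayPhase`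
chosen for a horizon `T_max` (`Λ ≥ e′δ₂T_max`) that exceeds the slow ignition bound,
`log(h/u(0))/(e(1−ε)) < T_max` (`ε = δ₁ + gδ₂/e`): there is a first ignition time `T_h`,
`0 < T_h ≤ T_max`, `u(T_h) = h`, `u < h` on `[0, T_h)`, with
`log(h/u(0))/e ≤ T_h ≤ log(h/u(0))/(e(1−ε))`, and at ignition `1 − δ₁ ≤ x ≤ 1`, `y(0) ≤ y ≤ δ₂`,
`v(0) + β(1−δ₁)(h − u(0))/e ≤ v ≤ e^{2Λ}(v(0) + 2βh/e)`. [folklore] -/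
theorem heteroclinicTriggerChain_trunc_ignition_exists (e g e' β : ℝ) (he : 0 < e) (hg : 0 < g)
    (he' : 0 ≤ e') (hβ : 0 ≤ β) (x u y v : ℝ → ℝ)
    (hx : ∀ t, HasDerivAt x (-(e * u t ^ 2) - β * u t * v t) t)
    (hu : ∀ t, HasDerivAt u (e * x t * u t - g * u t * y t) t)
    (hy : ∀ t, HasDerivAt y (g * u t ^ 2 - e' * v t ^ 2) t)
    (hv : ∀ t, HasDerivAt v (β * x t * u t + e' * y t * v t) t)
    (hE : x 0 ^ 2 + u 0 ^ 2 + y 0 ^ 2 + v 0 ^ 2 ≤ 1)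
    (hu0 : 0 < u 0) (hy0 : 0 ≤ y 0) (hv0 : 0 ≤ v 0)
    {Tmax h Λ δ₁ δ₂ V : ℝ} (huh0 : u 0 < h)
    (hδ₂ : y 0 + g * h ^ 2 / e ≤ δ₂) (hΛT : e' * δ₂ * Tmax ≤ Λ)
    (hV : Real.exp (2 * Λ) * (v 0 + 2 * β * h / e) ≤ V)
    (hδ₁ : 1 - x 0 + h ^ 2 + 2 * β * V * h / e ≤ δ₁)
    (hsmall : 2 * δ₁ + 2 * g * δ₂ / e ≤ 1 / 2)
    (hv0u0 : 4 * e' * Real.exp (4 * Λ) * v 0 ^ 2 ≤ g * u 0 ^ 2)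
    (hβe : 16 * e' * β ^ 2 * Real.exp (4 * Λ) ≤ g * e ^ 2)
    (hTmax : Real.log (h / u 0) / (e * (1 - (δ₁ + g * δ₂ / e))) < Tmax) :
    ∃ T : ℝ, 0 < T ∧ T ≤ Tmax ∧ u T = h ∧ (∀ s ∈ Ico 0 T, u s < h) ∧
      Real.log (h / u 0) / e ≤ T ∧ T ≤ Real.log (h / u 0) / (e * (1 - (δ₁ + g * δ₂ / e))) ∧
      1 - δ₁ ≤ x T ∧ x T ≤ 1 ∧ y 0 ≤ y T ∧ y T ≤ δ₂ ∧
      v 0 + β * (1 - δ₁) * (h - u 0) / e ≤ v T ∧ v T ≤ Real.exp (2 * Λ) * (v 0 + 2 * β * h / e) := by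
  have huc : Continuous u := continuous_iff_continuousAt.2 fun t => (hu t).continuousAt
  have hhpos : 0 < h := hu0.trans huh0
  have hδ₂nn : 0 ≤ δ₂ := by
    have : 0 ≤ g * h ^ 2 / e := by positivity
    linarith
  -- the slow ignition bound is nonnegative, so the horizon is positive
  have hεpos : 0 < 1 - (δ₁ + g * δ₂ / e) := by
    have h2 : 2 * (δ₁ + g * δ₂ / e) = 2 * δ₁ + 2 * g * δ₂ / e := by ring
    linarith
  have hlog : 0 ≤ Real.log (h / u 0) := Real.log_nonneg (by rw [le_div_iff₀ hu0]; linarith)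
  have hTmax0 : 0 ≤ Tmax := le_trans (div_nonneg hlog (mul_pos he hεpos).le) hTmax.le
  -- the set of ignited times in [0, Tmax] is nonempty (else the lower exponential law overshoots)
  set S : Set ℝ := Icc 0 Tmax ∩ u ⁻¹' Ici h with hS
  have hSne : S.Nonempty := by
    by_contra hemp
    rw [Set.not_nonempty_iff_eq_empty] at hemp
    have hle : ∀ s ∈ Icc 0 Tmax, u s ≤ h := by
      intro s hs
      by_contra hcon
      push Not at hcon
      have hmem : s ∈ S := ⟨hs, hcon.le⟩
      rw [hemp] at hmem
      exact hmem
    have h1 := (heteroclinicTriggerChain_trunc_ignitionTime e g e' β he hg he' hβ x u y v hx hu hy hv hE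
      hu0 hy0 hv0 hTmax0 hδ₂ hΛT hV hδ₁ hsmall hv0u0 hβe hle).1
    linarith
  have hSbdd : BddBelow S := ⟨0, fun s hs => hs.1.1⟩
  have hSclosed : IsClosed S := isClosed_Icc.inter (isClosed_Ici.preimage huc)
  obtain ⟨⟨hT0, hTTmax⟩, hTh⟩ : sInf S ∈ S := hSclosed.csInf_mem hSne hSbdd
  set T : ℝ := sInf S with hTdef
  have hTh' : h ≤ u T := hTh
  have hbefore : ∀ s ∈ Ico 0 T, u s < h := by
    intro s hs
    by_contra hcon
    push Not at hcon
    have hmem : s ∈ S := ⟨⟨hs.1, hs.2.le.trans hTTmax⟩, hcon⟩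
    exact absurd (csInf_le hSbdd hmem) (not_le.2 hs.2)
  have hTpos : 0 < T := by
    rcases hT0.eq_or_lt with h0 | h0
    · exfalso
      rw [← h0] at hTh'
      linarith
    · exact h0
  -- continuity from the left: u(T) ≤ h
  have huT : u T = h := by
    refine le_antisymm ?_ hTh'
    have hsub : Ico 0 T ⊆ u ⁻¹' Iic h := fun s hs => (hbefore s hs).le
    have hcl : closure (Ico 0 T) ⊆ u ⁻¹' Iic h :=
      (isClosed_Iic.preimage huc).closure_subset_iff.2 hsub
    have hTcl : T ∈ closure (Ico 0 T) := by
      rw [closure_Ico hTpos.ne]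
      exact ⟨hTpos.le, le_rfl⟩
    exact hcl hTcl
  have hle : ∀ s ∈ Icc 0 T, u s ≤ h := by
    intro s hs
    rcases hs.2.eq_or_lt with h1 | h1
    · rw [h1, huT]
    · exact (hbefore s ⟨hs.1, h1⟩).le
  have hΛT' : e' * δ₂ * T ≤ Λ := le_trans (mul_le_mul_of_nonneg_left hTTmax (by positivity)) hΛT
  have hmem : T ∈ Icc 0 T := ⟨hTpos.le, le_rfl⟩
  obtain ⟨h1, h2, h3, h4, -, -, h7, -, -, h10⟩ :=
    heteroclinicTriggerChain_trunc_delayPhase e g e' β he hg he' hβ x u y v hx hu hy hv hE hu0 hy0 hv0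
      hTpos.le hδ₂ hΛT' hV hδ₁ hsmall hv0u0 hβe hle T hmem
  obtain ⟨h11, h12⟩ :=
    heteroclinicTriggerChain_trunc_ignitionTime e g e' β he hg he' hβ x u y v hx hu hy hv hE hu0 hy0 hv0
      hTpos.le hδ₂ hΛT' hV hδ₁ hsmall hv0u0 hβe hle
  refine ⟨T, hTpos, hTTmax, huT, hbefore, h12 huT, h11, h1, h2, h3, h4, ?_, ?_⟩
  · rw [huT] at h10
    exact h10
  · rw [huT] at h7
    exact h7

end Summit.NavierStokesRegularity.NavierStokesRegularity.Theorems

end
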